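import Summits.RiemannHypothesis.RiemannHypothesis.Theorems.Splittings.RobinFiniteKernelHeightCore
import HarnessLib

/-!
# RobinFiniteKernelHeightFree — THE KERNEL HEIGHT PAYS, PRINT-FREE: `RiemannHypothesisUpTo 100000` ALONE (the height of the tree's own certificate)
# buys `robinCA_below 8886114` and Robin's inequality for every `5040 < n ≤ 10^3845000` (SPLIT-robin-finite gen 15, part 3/4)

Cell rh-split, card `cards/SPLIT-robin-finite.md` §22.  HONEST LABEL: «SPLITTING SEARCH over kernel-typed RH-EQUIVALENCES; a
splitting A ∧ B ⟹ RH is CONDITIONAL bookkeeping unless A and B are both proved; nothing here bears on the truth of RH.»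

HEADLINES (standard axioms; the ONLY hypothesis is `RiemannHypothesisUpTo 100000`, a tree THEOREM — discharged in part 4, computational class):
`robinCA_below_of_rhKernelFree : RiemannHypothesisUpTo 100000 → robinCA_below 8886114` (Robin at every colossally abundant `N > 5040` all of whose
primes are `≤ 8 886 113`; tree, unconditionally: primes `< 4¹¹ = 4 194 304`, `robinCA_below_four_pow_eleven`) and
`robin_le_of_rhKernelFree : RiemannHypothesisUpTo 100000 → ∀ 5040 < n ≤ 10^3845000, σ(n) < e^γ n log log n` (tree, unconditionally:
`n ≤ 10^1958000`, `robinInequality_le_ten_pow_1958000`), the latter through the PRINT-FREE parameter bridge `robin_all_of_robinCA_below_thetaLB`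
(Robin 1984 §3 Prop. 1 interpolation between consecutive CA numbers, tree `exists_consecutive`/`robin_between_CA`, over a `θ` LOWER BOUND in
hypothesis position) fed with the KERNEL value `θ(8 886 112) ≥ 8 855 740 ≥ 3 845 000·log 10` (`theta_8886112_ge`, from `abs_theta_sub_le_smallRange`).
0 `def`, 0 `sorry`, no `native_decide`, no named fact, no conjecture in hypothesis position.  Nothing here bears on the truth of RH.
-/

set_option linter.dupNamespace false

noncomputable section

open Real Filter Finset
open scoped Chebyshev ComplexConjugate

namespace Summit.RiemannHypothesis.RiemannHypothesis.Theorems.Splittings.RobinFiniteC1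

open Literature.NumberTheory.LFunctions Literature.NumberTheory.DiophantineGeometry
open RobinAnalyticSharp RobinAnalyticSharp.Cells
open NicolasJ NicolasFz NicolasK NicolasJExplicit
open Summit.RiemannHypothesis.RiemannHypothesis.Theorems.Splittings.RobinFiniteE3
open Summit.RiemannHypothesis.RiemannHypothesis.Theorems.Splittings.RobinFiniteTail (zeroTailBound_tailH tailH_nonneg tailH_1e5_le)
open Summit.RiemannHypothesis.RiemannHypothesis.Theorems.Splittings.RobinFiniteE1c

section KernelHeightFree

/-! ### The kernel value `θ(8 886 112) ≥ 8 855 740` -/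


/-- `log 8886112 ≤ 16.001` (`e¹⁶·e^{0.001} ≥ 2.7182818283¹⁶·1.001 ≥ 8 894 000`). -/
theorem log_8886112_le : Real.log 8886112 ≤ 16.001 := by
  rw [Real.log_le_iff_le_exp (by norm_num)]
  have h1 : Real.exp 16.001 = Real.exp 1 ^ 16 * Real.exp 0.001 := by
    rw [← Real.exp_nat_mul, ← Real.exp_add]; norm_num
  have h2 : (2.7182818283 : ℝ) ^ 16 ≤ Real.exp 1 ^ 16 := pow_le_pow_left₀ (by norm_num) Real.exp_one_gt_d9.le 16
  have h3 : (1.001 : ℝ) ≤ Real.exp 0.001 := by have := Real.add_one_le_exp (0.001 : ℝ); linarith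
  have h4 : (8886112 : ℝ) ≤ 2.7182818283 ^ 16 * 1.001 := by norm_num
  calc (8886112 : ℝ) ≤ 2.7182818283 ^ 16 * 1.001 := h4
    _ ≤ Real.exp 1 ^ 16 * Real.exp 0.001 := mul_le_mul h2 h3 (by norm_num) (by positivity)
    _ = Real.exp 16.001 := h1.symm

/-- **K5b · `θ(8 886 112) ≥ 8 855 740`, unconditionally, from the KERNEL table** (`abs_theta_sub_le_smallRange` at `y = 8 886 112`:
`√y log²y/(8π) ≤ 2981·16.001²/(8·3.141592) ≤ 30 369`). -/
theorem theta_8886112_ge : (8855740 : ℝ) ≤ θ 8886112 := by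
  have h := abs_theta_sub_le_smallRange (x := 8886112) (by norm_num) (by norm_num)
  have hs : √(8886112 : ℝ) ≤ 2981 := by rw [Real.sqrt_le_left (by norm_num)]; norm_num
  have hlog := log_8886112_le
  have hlog0 : 0 ≤ Real.log 8886112 := Real.log_nonneg (by norm_num)
  have hπ := Real.pi_gt_d6
  have hnum : √(8886112 : ℝ) * Real.log 8886112 ^ 2 ≤ 2981 * 16.001 ^ 2 :=
    mul_le_mul hs (pow_le_pow_left₀ hlog0 hlog 2) (sq_nonneg _) (by norm_num)
  have hden : (8 : ℝ) * 3.141592 ≤ 8 * π := by linarith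
  have hq : √(8886112 : ℝ) * Real.log 8886112 ^ 2 / (8 * π) ≤ 2981 * 16.001 ^ 2 / (8 * 3.141592) :=
    div_le_div₀ (by norm_num) hnum (by norm_num) hden
  have hq' : (2981 : ℝ) * 16.001 ^ 2 / (8 * 3.141592) ≤ 30369 := by norm_num
  have h1 := (abs_le.1 h).1
  linarith

/-! ### K5a · the PRINT-FREE parameter bridge (CA range + a `θ` lower bound ⟹ all integers) -/

/-- **K5a · the parameter bridge over a `θ` LOWER BOUND in hypothesis position** (tree `robin_all_of_robinCA_below_low`, whose `θ`-input
`θ(x) ≥ 0.99947x` needs Büthe 2018 + BKLNW and `x ≥ 2²⁴`): `robinCA_below (X + 1)`, `2 ≤ X` and `log 5040 < L ≤ θ(X − 1)` give Robin's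
inequality for every `5040 < n` with `log n ≤ L` (Robin 1984 §3 Prop. 1 via `robin_all_of_robinCA_below`; `N⋆` a maximiser at
`ε = log(1 + 1/X)/log X`, `log N⋆ ≥ θ(X − 1)`). -/
theorem robin_all_of_robinCA_below_thetaLB {X : ℕ} (hRB : robinCA_below (X + 1)) (hX : 2 ≤ X) {L : ℝ}
    (hL : Real.log 5040 < L) (hW1 : L ≤ θ ((X : ℝ) - 1)) :
    ∀ n : ℕ, 5040 < n → Real.log n ≤ L → robinInequality n := by
  classical
  have hXR : (2 : ℝ) ≤ (X : ℝ) := by exact_mod_cast hX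
  set ε : ℝ := Real.log (1 + 1 / (X : ℝ)) / Real.log (X : ℝ) with hε_def
  have hBs1 : (1 : ℝ) < (X : ℝ) := by linarith
  have hε : 0 < ε := by
    refine div_pos (Real.log_pos ?_) (Real.log_pos hBs1)
    have : (0 : ℝ) < 1 / (X : ℝ) := by positivity
    linarith
  obtain ⟨Ns, hNs1, hNs, -⟩ := Nat.exists_greatest_isCAParameter hε
  have hNs0 : Ns ≠ 0 := by omega
  have hthr : ∀ r : ℕ, r.Prime → (r : ℝ) ^ ε ≤ 1 + 1 / r → r < X + 1 := by
    intro r hr hle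
    by_contra hge
    push Not at hge
    have hr' : (X : ℝ) < r := by
      have : ((X + 1 : ℕ) : ℝ) ≤ r := by exact_mod_cast hge
      push_cast at this; linarith
    have := one_add_inv_lt_rpow hBs1 hr'
    rw [← hε_def] at this
    linarith
  have hdiv : ∀ p ∈ Nat.primesLE (X - 1), p ∣ Ns := by
    intro p hp
    obtain ⟨hple, hpp⟩ := Nat.mem_primesLE.1 hp
    refine dvd_of_rpow_lt hNs hNs0 hpp (rpow_lt_one_add_inv hBs1 (by exact_mod_cast hpp.one_lt) ?_)
    have h1 : p < X := by omega
    exact_mod_cast h1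
  have hprod : (∏ p ∈ Nat.primesLE (X - 1), p) ∣ Ns :=
    Finset.prod_primes_dvd Ns (fun p hp => (Nat.mem_primesLE.1 hp).2.prime) hdiv
  have hlogNs : L ≤ Real.log Ns := by
    have hle : (∏ p ∈ Nat.primesLE (X - 1), p) ≤ Ns := Nat.le_of_dvd (by omega) hprod
    have hpos : ∀ p ∈ Nat.primesLE (X - 1), ((p : ℕ) : ℝ) ≠ 0 := fun p hp => by
      exact_mod_cast (Nat.mem_primesLE.1 hp).2.ne_zero
    have h1 : Real.log ((∏ p ∈ Nat.primesLE (X - 1), p : ℕ) : ℝ) = θ (((X - 1 : ℕ)) : ℝ) := by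
      rw [Chebyshev.theta_eq_sum_primesLE_log, Nat.cast_prod, Real.log_prod hpos]
    have hprodpos : (0 : ℝ) < ((∏ p ∈ Nat.primesLE (X - 1), p : ℕ) : ℝ) := by
      rw [Nat.cast_prod]; exact Finset.prod_pos fun p hp => by exact_mod_cast (Nat.mem_primesLE.1 hp).2.pos
    have h2 : Real.log ((∏ p ∈ Nat.primesLE (X - 1), p : ℕ) : ℝ) ≤ Real.log Ns :=
      Real.log_le_log hprodpos (by exact_mod_cast hle)
    have hcast : (((X - 1 : ℕ)) : ℝ) = (X : ℝ) - 1 := Nat.cast_pred (by omega)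
    rw [h1, hcast] at h2
    exact hW1.trans h2
  have hNs5040 : 5040 < Ns := by
    by_contra hle
    push Not at hle
    have h1 : (Ns : ℝ) ≤ 5040 := by exact_mod_cast hle
    have h2 : Real.log Ns ≤ Real.log 5040 := Real.log_le_log (by exact_mod_cast hNs1) h1
    linarith
  intro n hn hlog
  refine robin_all_of_robinCA_below hRB hε hthr hNs hNs5040 n hn ?_
  by_contra hgt
  push Not at hgt
  have h3 : Real.log Ns < Real.log n :=
    Real.log_lt_log (by exact_mod_cast hNs1) (by exact_mod_cast hgt)
  linarith

/-! ### F5 · THE KERNEL HEIGHT PAYS, PRINT-FREE: `RiemannHypothesisUpTo 100000` alone in hypothesis position -/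

/-- **F5a · `RiemannHypothesisUpTo 100000 → robinCA_below 8886114`** (standard axioms; NO print fact): the height of the tree's own kernel
certificate `riemannHypothesisUpTo_100000` buys every colossally abundant `N > 5040` whose primes are `≤ 8 886 113` (tree, unconditionally:
primes `< 4¹¹ = 4 194 304`, `robinCA_below_four_pow_eleven`).  Nothing here bears on RH. -/
theorem robinCA_below_of_rhKernelFree (hRH : RiemannHypothesisUpTo 100000) : robinCA_below 8886114 :=
  robinCA_below_kernelWindowFree (X := 8886113) (by norm_num) hRH (by norm_num) level11_kernelFree_condition

/-- The same from RH verified to any height `T ≥ 10⁵`. -/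
theorem robinCA_below_of_rh1e5Free {T : ℝ} (hT : 100000 ≤ T) (hRH : RiemannHypothesisUpTo T) :
    robinCA_below 8886114 :=
  robinCA_below_of_rhKernelFree (hRH.mono_of_le hT)

/-- **F5b · `RiemannHypothesisUpTo 100000 → ∀ 5040 < n ≤ 10^3845000, σ(n) < e^γ n log log n`** (standard axioms; NO print fact;
tree, unconditionally: `n ≤ 10^1958000`, `robinInequality_le_ten_pow_1958000`).  Print-free bridge K5a with the kernel
value `θ(8 886 112) ≥ 8 855 740`.  Nothing here bears on the truth of RH. -/
theorem robin_le_of_rhKernelFree (hRH : RiemannHypothesisUpTo 100000) :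
    ∀ n : ℕ, 5040 < n → n ≤ 10 ^ 3845000 → robinInequality n := by
  have hRB : robinCA_below (8886113 + 1) := robinCA_below_of_rhKernelFree hRH
  intro n hn hle
  -- `hle` is consumed by `log_le_of_le_ten_pow` and CLEARED: the power is never evaluated.
  have hn0 : 0 < n := lt_of_le_of_lt (Nat.zero_le 5040) hn
  have h1 : Real.log n ≤ ((3845000 : ℕ) : ℝ) * Real.log 10 := log_le_of_le_ten_pow hn0 hle
  clear hle
  have hθ : (8855740 : ℝ) ≤ θ (((8886113 : ℕ) : ℝ) - 1) := by
    have hc : (((8886113 : ℕ) : ℝ) - 1) = 8886112 := by norm_num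
    rw [hc]; exact theta_8886112_ge
  have hL : Real.log 5040 < 8855740 := lt_of_le_of_lt (Real.log_le_sub_one_of_pos (by norm_num)) (by norm_num)
  refine robin_all_of_robinCA_below_thetaLB hRB (by norm_num) hL hθ n hn ?_
  have h10 := RobinAnalytic.log_ten_lt
  have h9 : ((3845000 : ℕ) : ℝ) = 3845000 := by norm_num
  rw [h9] at h1
  nlinarith

/-- The same from RH verified to any height `T ≥ 10⁵`. -/
theorem robin_le_of_rh1e5Free {T : ℝ} (hT : 100000 ≤ T) (hRH : RiemannHypothesisUpTo T) :
    ∀ n : ℕ, 5040 < n → n ≤ 10 ^ 3845000 → robinInequality n :=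
  robin_le_of_rhKernelFree (hRH.mono_of_le hT)

/-! ### Guards: standard axioms only — RH(10⁵) is the ONLY hypothesis; no named fact, no `native_decide`, no `sorry` -/

/-- info: 'Summit.RiemannHypothesis.RiemannHypothesis.Theorems.Splittings.RobinFiniteC1.robinCA_below_of_rhKernelFree' depends on axioms: [propext, Classical.choice, Quot.sound] -/
#guard_msgs (whitespace := lax) in
#print axioms robinCA_below_of_rhKernelFree

/-- info: 'Summit.RiemannHypothesis.RiemannHypothesis.Theorems.Splittings.RobinFiniteC1.robin_le_of_rhKernelFree' depends on axioms: [propext, Classical.choice, Quot.sound] -/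
#guard_msgs (whitespace := lax) in
#print axioms robin_le_of_rhKernelFree

end KernelHeightFree

end Summit.RiemannHypothesis.RiemannHypothesis.Theorems.Splittings.RobinFiniteC1

end
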